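import Summits.CriticalPhenomena.Ising3DConformalLimit.Theses.InverseSquareTelemetry

/-!
# STRATEGY-CENSUS signatures — typed statements quoted in `STRATEGY-CENSUS.md` for crux
`InverseSquareTelemetry.InverseSquareLaw` (stmt-CriticalPhenomena-4495)

Nothing here is proposed to the tree; these are the signatures quoted in `STRATEGY-CENSUS.md`
(Strengthen / Decomposition / Transfer-on-the-axis / Negation), checked to elaborate.
`G := criticalTwoPoint 3`, `s(x) := Σ xᵢ²`, `|x|₂ := √s`.
-/

namespace Summit.CriticalPhenomena.Ising3DConformalLimit.Cruxes.InverseSquareLaw.Strategist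

open Filter Topology Literature.Probability.LatticeModels
open Summit.CriticalPhenomena.Ising3DConformalLimit.Theses.InverseSquareTelemetry

/-- Euclidean norm `|x|₂` on `ℤ³`. -/
noncomputable def enorm (x : Site 3) : ℝ := Real.sqrt (∑ i, ((x i : ℝ)) ^ 2)

/-- The 6-neighbour lattice Laplacian. -/
noncomputable def lap (f : Site 3 → ℝ) (x : Site 3) : ℝ :=
  (∑ i : Fin 3, (f (x + Pi.single i 1) + f (x - Pi.single i 1))) - 6 * f x

/-- The telemetry `T(x) = |x|₂² · (Δ G)(x) / G(x)`. -/
noncomputable def telemetry (x : Site 3) : ℝ :=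
  (enorm x) ^ 2 * (lap (criticalTwoPoint 3) x / criticalTwoPoint 3 x)

/-- Forward difference in direction `v`. -/
def fwdDiff (v : Site 3) (f : Site 3 → ℝ) : Site 3 → ℝ := fun x => f (x + v) - f x

/-- Iterated forward differences along a list of coordinate directions. -/
def iterDiff : List (Fin 3) → (Site 3 → ℝ) → (Site 3 → ℝ)
  | [], f => f
  | i :: l, f => fwdDiff (Pi.single i 1) (iterDiff l f)

/-! ## Strengthen: S⁺ = C²-regular (Euclidean) pure power law -/

/-- Relative remainder of `G` against the model `A |x|₂^{-a}`. -/
noncomputable def rem (a A : ℝ) (x : Site 3) : ℝ :=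
  criticalTwoPoint 3 x / (A * (enorm x) ^ (-a)) - 1

/-- **S⁺ (C2PowerLaw).** `G(x) = A|x|₂^{-a}(1 + R(x))` with `R`, its first differences and its
lattice Laplacian dimensionally small: `|R| ≤ C|x|^{-ε}`, `|∇R| ≤ C|x|^{-1-ε}`, `|ΔR| ≤ C|x|^{-2-ε}`. -/
def C2PowerLaw : Prop :=
  ∃ a A ε C : ℝ, 1 ≤ a ∧ 0 < A ∧ 0 < ε ∧ ∀ x : Site 3, x ≠ 0 →
    |rem a A x| ≤ C * (enorm x) ^ (-ε) ∧
    (∀ i : Fin 3, |rem a A (x + Pi.single i 1) - rem a A x| ≤ C * (enorm x) ^ (-(1 + ε))) ∧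
    |lap (rem a A) x| ≤ C * (enorm x) ^ (-(2 + ε))

/-- Census claim (Strengthen): `C2PowerLaw → InverseSquareLaw` is lattice Taylor algebra
(`Δ|x|^{-a} = a(a-1)|x|^{-a-2} + O(|x|^{-a-4})`, product rule), `κ = a(a-1) ≥ 0` from `a ≥ 1`. -/
def StrengthenGlue : Prop := C2PowerLaw → InverseSquareLaw

/-! ## Decomposition D1: pointwise law with rate ∧ dimensional regularity of order m -/

/-- **Sub₁ (PowerLawRate)** = item 0634 WITH a power rate (Euclidean, isotropic amplitude). -/
def PowerLawRate : Prop :=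
  ∃ a A ε C : ℝ, 0 < A ∧ 0 < ε ∧ ∀ x : Site 3, x ≠ 0 →
    |criticalTwoPoint 3 x * (enorm x) ^ a - A| ≤ C * (enorm x) ^ (-ε)

/-- **Sub₂ (DimensionalRegularity m)**: every `m`-th lattice difference of `G` gains `|x|^{-m}`
(scale-invariant regularity, no constant, no isotropy, no rate). -/
def DimensionalRegularity (m : ℕ) : Prop :=
  ∃ C : ℝ, ∀ l : List (Fin 3), l.length = m → ∀ x : Site 3, x ≠ 0 →
    |iterDiff l (criticalTwoPoint 3) x| ≤ C * criticalTwoPoint 3 x * (enorm x) ^ (-(m : ℝ))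

/-- Census claim (Decomposition D1): discrete Landau–Kolmogorov interpolation between
`|R| ≤ C|x|^{-ε}` and `|∇^m R| ≤ C|x|^{-m}` on balls of radius `|x|^{1-ε/m}` gives
`|ΔR| ≤ C|x|^{-2-ε(1-2/m)}`, hence the crux with rate `ε(1-2/m)`; `m ≥ 3`. -/
def D1Glue : Prop := PowerLawRate → DimensionalRegularity 3 → InverseSquareLaw

/-! ## Transfer on the axis (what RP complete monotonicity buys) -/

/-- **AxisPowerLawRate**: one-dimensional pure power law of the axial two-point function with rate
(no isotropy content; `n ↦ G(n e₀)` is a Hausdorff moment sequence, tree: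
`AizenmanDuminilCopin2021_prop_8_6`). -/
def AxisPowerLawRate : Prop :=
  ∃ a A ε C : ℝ, 0 < A ∧ 0 < ε ∧ ∀ n : ℕ, 1 ≤ n →
    |criticalTwoPoint 3 (Pi.single 0 (n : ℤ)) * (n : ℝ) ^ a - A| ≤ C * (n : ℝ) ^ (-ε)

/-- **AxialTelemetry** (PROVABLE from `AxisPowerLawRate` by the monotone-density argument for the
completely monotone sequence `n ↦ G(n e₀)`): the PARALLEL part of the telemetry on the axis tends to
`a(a+1)` at a power rate. -/
def AxialTelemetry : Prop :=
  ∀ a A ε C : ℝ, 0 < A → 0 < ε →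
    (∀ n : ℕ, 1 ≤ n → |criticalTwoPoint 3 (Pi.single 0 (n : ℤ)) * (n : ℝ) ^ a - A| ≤ C * (n : ℝ) ^ (-ε)) →
    ∃ ε' C' : ℝ, 0 < ε' ∧ ∀ n : ℕ, 1 ≤ n →
      |(n : ℝ) ^ 2 * ((criticalTwoPoint 3 (Pi.single 0 ((n : ℤ) + 1)) + criticalTwoPoint 3 (Pi.single 0 ((n : ℤ) - 1))
          - 2 * criticalTwoPoint 3 (Pi.single 0 (n : ℤ))) / criticalTwoPoint 3 (Pi.single 0 (n : ℤ))) - a * (a + 1)|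
        ≤ C' * (n : ℝ) ^ (-ε')

/-- **TransverseTelemetry** ("Pythagoras at the lattice scale" — the isolated hard core on the
axis): the transverse part `n² · Σ_{j≠0} (G(n e₀ + e_j) + G(n e₀ − e_j) − 2 G(n e₀)) / G(n e₀)` tends
to `−2a` at a power rate, i.e. `G(n e₀ + e_j)/G(n e₀) = 1 − a/(2n²) + O(n^{-2-ε})`. -/
def TransverseTelemetry : Prop :=
  ∃ a ε C : ℝ, 0 < ε ∧ ∀ n : ℕ, 1 ≤ n →
    |(n : ℝ) ^ 2 * ((∑ j : Fin 3, if j = 0 then 0 else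
        (criticalTwoPoint 3 (Pi.single 0 (n : ℤ) + Pi.single j 1) + criticalTwoPoint 3 (Pi.single 0 (n : ℤ) - Pi.single j 1)
          - 2 * criticalTwoPoint 3 (Pi.single 0 (n : ℤ)))) / criticalTwoPoint 3 (Pi.single 0 (n : ℤ))) + 2 * a|
      ≤ C * (n : ℝ) ^ (-ε)

/-! ## Decomposition D2 (geometric): bulk cone vs. near-coordinate-plane region -/

/-- The crux restricted to a region `P`. -/
def TelemetryOn (P : Site 3 → Prop) : Prop :=
  ∃ κ ε C : ℝ, 0 ≤ κ ∧ 0 < ε ∧ ∀ x : Site 3, x ≠ 0 → P x → |telemetry x - κ| ≤ C * (enorm x) ^ (-ε)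

/-- Bulk cone: every coordinate is a dominant direction. -/
def bulkCone (c : ℝ) (x : Site 3) : Prop := ∀ i : Fin 3, c * enorm x ≤ |(x i : ℝ)|

/-- D2: `TelemetryOn (bulkCone c) ∧ TelemetryOn (¬ bulkCone c ·) → InverseSquareLaw` needs the two
`κ` to agree — they do iff BOTH pieces overlap a common ray set; as typed (disjoint regions) the
glue FAILS without an extra matching statement, recorded in the census. -/
def D2Glue (c : ℝ) : Prop :=
  TelemetryOn (bulkCone c) → TelemetryOn (fun x => ¬ bulkCone c x) → InverseSquareLaw

/-! ## Negation: the anisotropic alternative is self-consistent -/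

/-- **RaywiseTelemetry**: direction-dependent telemetric limits `κ(x/|x|)` with a continuous
angular profile — the negation scenario (`¬ InverseSquareLaw` with everything else standard). -/
def RaywiseTelemetry : Prop :=
  ∃ κ : EuclideanSpace ℝ (Fin 3) → ℝ, Continuous κ ∧ (∃ u v, κ u ≠ κ v ∧ ‖u‖ = 1 ∧ ‖v‖ = 1) ∧
    Tendsto (fun x : Site 3 => telemetry x - κ ((enorm x)⁻¹ • (WithLp.toLp 2 fun i => (x i : ℝ))))
      cofinite (nhds 0)

end Summit.CriticalPhenomena.Ising3DConformalLimit.Cruxes.InverseSquareLaw.Strategist
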